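import Literature.Geometry.Lorentzian.RelativeDevelopmentGluingMetric
import Literature.Geometry.Lorentzian.TimelikeCurveLift
import Literature.Geometry.Lorentzian.CausalityClosedProofs
import Literature.Geometry.Lorentzian.ConvergenceTransport
import Literature.Geometry.Lorentzian.DevelopmentImmersionInjective
import HarnessLib

/-!
# Relative gluing of developments: the data hypersurface of the larger datum stays a Cauchy
# hypersurface of the glued spacetime (relative form of Sbierski 2016, §3.3, proof of Thm. 5)

Third file of the relative gluing construction (`RelativeDevelopmentGluingData`: the glued space
`M̃ = (M₁ ⊔ M₂)/∼` of a relative common development `𝔠 = (U ⊆ M₁, ψ : U → M₂)` of a Cauchy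
development `𝒟₁` of data `D₁` on `N` and a Cauchy development `𝒟₂` of data `D₂` on `X` over
`Φ : N → X`; `RelativeDevelopmentGluingMetric`: its metric `g̃` and time orientation `T̃`). Here:
**`Σ̃ := π j₂(ι₂(X))`, the image of the data hypersurface of the LARGER datum, is a Cauchy
hypersurface of `(M̃, g̃, T̃)`.** This is the step of the localisation argument (Hawking–Ellis
1973, §7.6, p. 250: *"the manifold `𝓜⁺ … ` would then be a development of `𝓢`"*;
Choquet-Bruhat–Geroch 1969, p. 334) that differs from the same-data case
(`DevelopmentGluingCauchy`, Sbierski 2016, §3.3), since `Σ̃` now lies in the piece `π j₂(M₂)`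
only, meeting the other piece in `π j₁(ι₁(N)) = π j₂(ι₂(Φ N))`:

* `RelCommonDevelopment.coe_mem_range_embed_of_map_mem` — **`ψ(U) ∩ ι₂(X) = ψ(ι₁(N))`**: a
  point of `U` mapped to the data hypersurface of `M₂` lies on `ι₁(N)` (the endless timelike curve
  of `U` through it meets `ι₁(N)`, and its image under `ψ` meets `ι₂(X)` at most once); hence
  `mem_range_inl_embed_of_mem`: `Σ̃ ∩ π j₁(M₁) = π j₁(ι₁(N))`, and `isClosed_range_gluedEmbed`;
* `crossing_inr`, `crossing_inl`, `crossing_overlap` — a piece of an endless timelike curve of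
  `M̃` inside `π j₂(M₂)`, `π j₁(M₁)`, `π j₁(U)` meets `Σ̃` (exactly once for the first two): lift
  along the injective local isometry (`LorentzianMetric.exists_lift_isEndlessTimelikeCurve`,
  `TimelikeCurveLift`) to an endless timelike curve of `M₂`, `M₁`, `U`, which meets the Cauchy
  hypersurface `ι₂(X)`, `ι₁(N)`, `ι₁(N)` there;
* `no_consecutive_crossings` — the relative uniqueness argument: between two consecutive
  crossings `t₁ < t₃` the curve leaves `π j₂(M₂)` (else one lift to `M₂` crosses `ι₂(X)` twice) at
  some `t'`; if it also leaves `π j₁(M₁)` in `(t₁, t₃)`, the overlap piece between the two exits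
  yields a crossing strictly in between (`exists_crossing_between`, as in the same-data case);
  otherwise `γ((t₁, t₃)) ⊆ π j₁(M₁)` and either both end points lie in `π j₁(M₁)` (one lift to
  `M₁` with two crossings of `ι₁(N)`), or the overlap piece through a parameter next to the end
  point outside `π j₁(M₁)` stays inside `(t₁, t₃)` and meets `Σ̃` — a crossing strictly in between;
* `isCauchyHypersurface_glued` — the statement.

Everything is proved; no definitions and no named facts are introduced (D-0026).

## References

* S. W. Hawking, G. F. R. Ellis, *The large scale structure of space-time*, CUP 1973, §7.6,
  pp. 249–251.
* Y. Choquet-Bruhat, R. Geroch, Comm. Math. Phys. 14 (1969) 329–335, proof of Thm. 3, p. 334.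
* J. Sbierski, Ann. Henri Poincaré 17 (2016) 301–329 = arXiv:1309.7591v3, §3.3, proof of
  Thm. 5 (global hyperbolicity step).
* B. O'Neill, *Semi-Riemannian geometry with applications to relativity*, 1983, Ch. 14,
  Def. 14.28, Lemma 14.29.
-/

noncomputable section

open Bundle Set Function Filter TopologicalSpace Topology Manifold
open scoped Manifold ContDiff Topology
open Literature.Topology.FourManifolds

namespace Literature.Geometry.Lorentzian

universe u

/-! ### Time-orientation preserving isometric immersions carry timelike curves to timelike curves -/

section Transport

variable {E : Type*} [NormedAddCommGroup E] [NormedSpace ℝ E] {H : Type*} [TopologicalSpace H]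
  {I : ModelWithCorners ℝ E H} {M : Type*} [TopologicalSpace M] [ChartedSpace H M]
  [IsManifold I ∞ M]
  {E' : Type*} [NormedAddCommGroup E'] [NormedSpace ℝ E'] {H' : Type*} [TopologicalSpace H']
  {I' : ModelWithCorners ℝ E' H'} {N : Type*} [TopologicalSpace N] [ChartedSpace H' N]
  [IsManifold I' ∞ N]
  {m : ℕ∞ω} {g : LorentzianMetric I m M} {τ : TimeOrientation g}
  {gN : LorentzianMetric I' m N} {τN : TimeOrientation gN}

/-- **Time-orientation preserving isometric immersions carry future timelike curves to future
timelike curves** (chain rule for the velocity; the differential preserves scalar products, and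
future-directedness by `PreservesTimeOrientation.isFutureDirected_mfderiv`). O'Neill 1983,
Ch. 3, pp. 90–91 and Ch. 14, p. 402. [cite: ONeillSemiRiemannian1983, Ch. 14, p. 402] -/
theorem LorentzianMetric.IsFutureTimelikeCurveOn.comp_isIsometricImmersion {φ : N → M}
    (hφd : MDifferentiable I' I φ) (hτ : τN.PreservesTimeOrientation φ τ)
    (hφ : ∀ y, pullbackBilin (I := I) (I' := I') φ g.val y = gN.val y) {γ : ℝ → N} {s : Set ℝ}
    (hγ : gN.IsFutureTimelikeCurveOn τN γ s) : g.IsFutureTimelikeCurveOn τ (φ ∘ γ) s := by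
  intro t ht
  obtain ⟨hd, htl, hfd⟩ := hγ t ht
  refine ⟨(hφd (γ t)).comp t hd, ?_⟩
  have hvel : velocity I (φ ∘ γ) t = mfderiv I' I φ (γ t) (velocity I' γ t) := by
    unfold velocity
    rw [mfderiv_comp t (hφd (γ t)) hd]
    rfl
  have key : ∀ u w : TangentSpace I' (γ t),
      g.val (φ (γ t)) (mfderiv I' I φ (γ t) u) (mfderiv I' I φ (γ t) w) = gN.val (γ t) u w :=
    fun u w ↦ by
    have h := congrArg (fun b ↦ b u w) (hφ (γ t))
    simpa only [pullbackBilin_apply] using h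
  rw [hvel]
  refine ⟨?_, hτ.isFutureDirected_mfderiv hφ hfd⟩
  show g.val (φ (γ t)) (mfderiv I' I φ (γ t) (velocity I' γ t))
    (mfderiv I' I φ (γ t) (velocity I' γ t)) < 0
  rw [key]
  exact htl

end Transport

/-! ### The three injective local isometries into the glued spacetime -/

section Developments

variable {n : ℕ} {N : Type u} [TopologicalSpace N] [ChartedSpace (EuclideanSpace ℝ (Fin n)) N]
  [IsManifold (𝓡 n) ∞ N] [ConnectedSpace N] {D₁ : InitialDataSet (𝓡 n) N}
  {X : Type u} [TopologicalSpace X] [ChartedSpace (EuclideanSpace ℝ (Fin n)) X]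
  [IsManifold (𝓡 n) ∞ X] [ConnectedSpace X] {D₂ : InitialDataSet (𝓡 n) X}

namespace CauchyDevelopment

namespace RelCommonDevelopment

variable {𝒟₁ : CauchyDevelopment D₁} {𝒟₂ : CauchyDevelopment D₂} {Φ : N → X}
  (𝔠 : RelCommonDevelopment 𝒟₁ 𝒟₂ Φ)

/-- `π j₁ : M₁ → M̃` is a local diffeomorphism (an isometric immersion between equidimensional
Lorentzian manifolds). [folklore] -/
theorem isLocalDiffeomorph_inl : IsLocalDiffeomorph (𝓡 (n + 1)) (𝓡 (n + 1)) ∞ 𝔠.inl :=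
  LorentzianMetric.isLocalDiffeomorph_of_isIsometricImmersion 𝔠.isIsometricImmersion_inl

/-- `π j₂ : M₂ → M̃` is a local diffeomorphism. [folklore] -/
theorem isLocalDiffeomorph_inr : IsLocalDiffeomorph (𝓡 (n + 1)) (𝓡 (n + 1)) ∞ 𝔠.inr :=
  LorentzianMetric.isLocalDiffeomorph_of_isIsometricImmersion 𝔠.isIsometricImmersion_inr

/-- **The overlap `π j₁(U) = π j₁(M₁) ∩ π j₂(M₂)`** is the range of `π j₁` restricted to `U`.
[cite: Sbierski2016AHP, §3.3, proof of Thm. 5] -/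
theorem range_inl_comp_subtypeVal :
    range (𝔠.inl ∘ (Subtype.val : 𝔠.opens → 𝒟₁.carrier)) = range 𝔠.inl ∩ range 𝔠.inr := by
  ext p
  constructor
  · rintro ⟨y, rfl⟩
    refine ⟨⟨y.1, rfl⟩, ?_⟩
    exact 𝔠.glueData.inl_mem_range_inr_iff.2 (by rw [glueData_glue, glue_source]; exact y.2)
  · rintro ⟨⟨a, rfl⟩, ha⟩
    have ha' : a ∈ 𝔠.opens := by
      have h := 𝔠.glueData.inl_mem_range_inr_iff.1 ha
      rw [glueData_glue, glue_source] at h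
      exact h
    exact ⟨⟨a, ha'⟩, rfl⟩

/-- **The overlap map `π j₁|_U : U → M̃` is an isometric immersion** of the open sub-spacetime
`(U, g₁|_U)`. [cite: Sbierski2016AHP, §3.3, proof of Thm. 5] -/
theorem isIsometricImmersion_inl_comp_subtypeVal :
    (𝒟₁.metric.restrict PseudoRiemannianMetric.contMDiff_restrict_holds 𝔠.opens).IsIsometricImmersion
      𝔠.gluedMetric.toPseudoRiemannianMetric (𝔠.inl ∘ (Subtype.val : 𝔠.opens → 𝒟₁.carrier)) := by
  have hd : MDifferentiable (𝓡 (n + 1)) (𝓡 (n + 1)) 𝔠.inl :=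
    𝔠.glueData.contMDiff_inl.mdifferentiable (by simp)
  refine ⟨𝔠.glueData.contMDiff_inl.comp contMDiff_subtype_val, fun y ↦ ?_⟩
  ext v w
  rw [pullbackBilin_apply, mfderiv_comp_subtypeVal (hd _)]
  exact 𝔠.val_gluedMetric_inl y.1 v w

/-- The overlap map preserves the time orientations. [cite: Sbierski2016AHP, §3.3, proof of Thm. 5] -/
theorem preservesTimeOrientation_inl_comp_subtypeVal (h : ¬ 𝔠.HasCorrespondingBoundaryPoints) :
    (𝒟₁.timeOrientation.restrict PseudoRiemannianMetric.contMDiff_restrict_holds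
      𝒟₁.timeOrientation.contMDiff_restrict_holds 𝔠.opens).PreservesTimeOrientation
      (𝔠.inl ∘ (Subtype.val : 𝔠.opens → 𝒟₁.carrier)) (𝔠.gluedTimeOrientation h) := by
  have hd : MDifferentiable (𝓡 (n + 1)) (𝓡 (n + 1)) 𝔠.inl :=
    𝔠.glueData.contMDiff_inl.mdifferentiable (by simp)
  intro y
  rw [mfderiv_comp_subtypeVal (hd _)]
  exact 𝔠.preservesTimeOrientation_inl h y.1

/-- The overlap map is an injective local diffeomorphism. [folklore] -/
theorem isLocalDiffeomorph_inl_comp_subtypeVal :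
    IsLocalDiffeomorph (𝓡 (n + 1)) (𝓡 (n + 1)) ∞ (𝔠.inl ∘ (Subtype.val : 𝔠.opens → 𝒟₁.carrier)) ∧
      Injective (𝔠.inl ∘ (Subtype.val : 𝔠.opens → 𝒟₁.carrier)) :=
  ⟨LorentzianMetric.isLocalDiffeomorph_of_isIsometricImmersion 𝔠.isIsometricImmersion_inl_comp_subtypeVal,
    𝔠.glueData.inl_injective.comp Subtype.val_injective⟩

/-! ### `ψ(U)` meets the data hypersurface of `M₂` only along `ψ(ι₁(N))` -/

/-- **A point of `U` mapped by `ψ` to the data hypersurface `ι₂(X)` lies on `ι₁(N)`**: the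
endless timelike curve of the globally hyperbolic `(U, g₁|_U)` through the point
(`exists_isEndlessTimelikeCurve_through`) meets `ι₁(N)`; its image under the time-orientation
preserving isometric immersion `ψ` is a timelike curve of `M₂` meeting the Cauchy hypersurface
`ι₂(X)` at both parameters, which therefore coincide (`IsCauchyHypersurface.eq_of_mem_of_mem`).
Hawking–Ellis 1973, §7.6, p. 250. [cite: HawkingEllis1973CUP, §7.6, p. 250] -/
theorem coe_mem_range_embed_of_map_mem (y : 𝔠.opens) (hy : 𝔠.map y ∈ range 𝒟₂.embed) :
    (y : 𝒟₁.carrier) ∈ range 𝒟₁.embed := by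
  have hn2 : (2 : ℕ∞ω) ≤ ∞ := WithTop.coe_le_coe.mpr le_top
  obtain ⟨Δ, D, hΔ, h0D, hΔ0⟩ := LorentzianMetric.exists_isEndlessTimelikeCurve_through
    (g := 𝒟₁.metric.restrict PseudoRiemannianMetric.contMDiff_restrict_holds 𝔠.opens)
    (τ := 𝒟₁.timeOrientation.restrict PseudoRiemannianMetric.contMDiff_restrict_holds
      𝒟₁.timeOrientation.contMDiff_restrict_holds 𝔠.opens) hn2 y
  obtain ⟨tc, ⟨htc, x, hx⟩, -⟩ := 𝔠.isCauchyHypersurface Δ D hΔ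
  have hmapd : MDifferentiable (𝓡 (n + 1)) (𝓡 (n + 1)) 𝔠.map :=
    𝔠.contMDiff_map.mdifferentiable (by simp)
  have hψΔ : 𝒟₂.metric.IsFutureTimelikeCurveOn 𝒟₂.timeOrientation (𝔠.map ∘ Δ) D :=
    LorentzianMetric.IsFutureTimelikeCurveOn.comp_isIsometricImmersion hmapd
      𝔠.preservesTimeOrientation 𝔠.isIsometricImmersion.2 hΔ.2.1
  have h0 : (𝔠.map ∘ Δ) 0 ∈ range 𝒟₂.embed := by rw [comp_apply, hΔ0]; exact hy
  have hc : (𝔠.map ∘ Δ) tc ∈ range 𝒟₂.embed := by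
    refine ⟨Φ x, ?_⟩
    rw [comp_apply, ← 𝔠.map_embedOpens x]
    congr 1
    exact Subtype.ext hx
  have h0c : (0 : ℝ) = tc := LorentzianMetric.IsCauchyHypersurface.eq_of_mem_of_mem hn2
    𝒟₂.isCauchyHypersurface hΔ.1 hψΔ h0D htc h0 hc
  subst h0c
  rw [← hΔ0]
  exact ⟨x, hx⟩

/-! ### The glued data hypersurface `Σ̃ = π j₂(ι₂(X))` -/

/-- `π j₁(ι₁ x) ∈ Σ̃` (`π j₁ ι₁ = π j₂ ι₂ Φ`). [cite: HawkingEllis1973CUP, §7.6, p. 250] -/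
theorem inl_embed_mem (x : N) : 𝔠.inl (𝒟₁.embed x) ∈ range (𝔠.inr ∘ 𝒟₂.embed) :=
  ⟨Φ x, (𝔠.inl_embed_eq_inr_embed x).symm⟩

/-- `Σ̃ ⊆ π j₂(M₂)`. [folklore] -/
theorem range_gluedEmbed_subset : range (𝔠.inr ∘ 𝒟₂.embed) ⊆ range 𝔠.inr := by
  rintro _ ⟨x, rfl⟩
  exact ⟨𝒟₂.embed x, rfl⟩

/-- **`Σ̃ ∩ π j₁(M₁) = π j₁(ι₁(N))`**: a point of `Σ̃` in the piece `π j₁(M₁)` is the image of a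
point of `ι₁(N)` (`coe_mem_range_embed_of_map_mem`). [cite: HawkingEllis1973CUP, §7.6, p. 250] -/
theorem mem_range_inl_embed_of_mem {p : 𝔠.Glued} (hp : p ∈ range (𝔠.inr ∘ 𝒟₂.embed))
    (hp' : p ∈ range 𝔠.inl) : p ∈ range (𝔠.inl ∘ 𝒟₁.embed) := by
  obtain ⟨x, rfl⟩ := hp
  obtain ⟨a, ha⟩ := hp'
  obtain ⟨haU, hmap⟩ := 𝔠.inl_eq_inr_iff.1 ha
  obtain ⟨u, hu⟩ := 𝔠.coe_mem_range_embed_of_map_mem ⟨a, haU⟩ ⟨x, hmap.symm⟩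
  exact ⟨u, by rw [comp_apply, hu]; exact ha⟩

/-- **`Σ̃` is closed in `M̃`**: its complement is `π j₁(M₁ ∖ ι₁(N)) ∪ π j₂(M₂ ∖ ι₂(X))`, open
since Cauchy hypersurfaces are closed (`IsCauchyHypersurface.isClosed_holds`) and `π j₁`, `π j₂`
are open maps. [cite: Sbierski2016AHP, §3.3, proof of Thm. 5] -/
theorem isClosed_range_gluedEmbed : IsClosed (range (𝔠.inr ∘ 𝒟₂.embed)) := by
  have hn2 : (2 : ℕ∞ω) ≤ ∞ := WithTop.coe_le_coe.mpr le_top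
  have h1 : IsClosed (range 𝒟₁.embed) :=
    LorentzianMetric.IsCauchyHypersurface.isClosed_holds hn2 𝒟₁.isCauchyHypersurface
  have h2 : IsClosed (range 𝒟₂.embed) :=
    LorentzianMetric.IsCauchyHypersurface.isClosed_holds hn2 𝒟₂.isCauchyHypersurface
  rw [← isOpen_compl_iff]
  have heq : (range (𝔠.inr ∘ 𝒟₂.embed))ᶜ =
      𝔠.inl '' (range 𝒟₁.embed)ᶜ ∪ 𝔠.inr '' (range 𝒟₂.embed)ᶜ := by
    ext p
    constructor
    · intro hp
      obtain (⟨a, rfl⟩ | ⟨b, rfl⟩) := 𝔠.glueData.exists_inl_or_inr p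
      · refine Or.inl ⟨a, fun ⟨x, hx⟩ ↦ hp ?_, rfl⟩
        rw [← hx]
        exact 𝔠.inl_embed_mem x
      · refine Or.inr ⟨b, fun ⟨x, hx⟩ ↦ hp ⟨x, ?_⟩, rfl⟩
        simp only [comp_apply, hx]
    · rintro (⟨a, ha, rfl⟩ | ⟨b, hb, rfl⟩) hp
      · obtain ⟨u, hu⟩ := 𝔠.mem_range_inl_embed_of_mem hp ⟨a, rfl⟩
        exact ha ⟨u, 𝔠.glueData.inl_injective hu⟩
      · obtain ⟨x, hx⟩ := hp
        exact hb ⟨x, 𝔠.glueData.inr_injective hx⟩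
  rw [heq]
  exact (𝔠.glueData.isOpenMap_inl _ h1.isOpen_compl).union
    (𝔠.glueData.isOpenMap_inr _ h2.isOpen_compl)

/-! ### Crossings of `Σ̃` by endless timelike curves of the glued spacetime -/

variable {𝔠}

/-- **A piece of an endless timelike curve of `M̃` inside `π j₂(M₂)` meets `Σ̃`, exactly once**
(lift to `M₂`, where `ι₂(X)` is a Cauchy hypersurface). [cite: Sbierski2016AHP, §3.3, proof of Thm. 5 (global hyperbolicity step)] -/
theorem crossing_inr (h : ¬ 𝔠.HasCorrespondingBoundaryPoints) {γ : ℝ → 𝔠.Glued} {s : Set ℝ}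
    (hγ : 𝔠.gluedMetric.IsEndlessTimelikeCurve (𝔠.gluedTimeOrientation h) γ s) {t₀ : ℝ}
    (ht₀ : t₀ ∈ s) (hγt₀ : γ t₀ ∈ range 𝔠.inr) :
    (∃ t ∈ connectedComponentIn (s ∩ γ ⁻¹' range 𝔠.inr) t₀, γ t ∈ range (𝔠.inr ∘ 𝒟₂.embed)) ∧
      ∀ t₁ ∈ connectedComponentIn (s ∩ γ ⁻¹' range 𝔠.inr) t₀,
        ∀ t₂ ∈ connectedComponentIn (s ∩ γ ⁻¹' range 𝔠.inr) t₀,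
          γ t₁ ∈ range (𝔠.inr ∘ 𝒟₂.embed) → γ t₂ ∈ range (𝔠.inr ∘ 𝒟₂.embed) → t₁ = t₂ := by
  haveI := 𝔠.t2Space_glued h
  obtain ⟨δ, hδ, hδc⟩ := LorentzianMetric.exists_lift_isEndlessTimelikeCurve 𝒟₂.timeOrientation
    (𝔠.gluedTimeOrientation h) 𝔠.isIsometricImmersion_inr (𝔠.preservesTimeOrientation_inr h)
    𝔠.glueData.inr_injective 𝔠.isLocalDiffeomorph_inr hγ ht₀ hγt₀
  have hmem : ∀ t ∈ connectedComponentIn (s ∩ γ ⁻¹' range 𝔠.inr) t₀,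
      (γ t ∈ range (𝔠.inr ∘ 𝒟₂.embed) ↔ δ t ∈ range 𝒟₂.embed) := fun t ht ↦ by
    constructor
    · rintro ⟨x, hx⟩
      refine ⟨x, 𝔠.glueData.inr_injective ?_⟩
      change 𝔠.inr (𝒟₂.embed x) = 𝔠.inr (δ t)
      rw [hδ t ht]
      exact hx
    · rintro ⟨x, hx⟩
      exact ⟨x, by change 𝔠.inr (𝒟₂.embed x) = γ t; rw [hx, hδ t ht]⟩
  refine ⟨?_, fun t₁ ht₁ t₂ ht₂ h₁ h₂ ↦ ?_⟩
  · obtain ⟨t, ⟨ht, hx⟩, -⟩ := 𝒟₂.isCauchyHypersurface δ _ hδc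
    exact ⟨t, ht, (hmem t ht).2 hx⟩
  · exact LorentzianMetric.IsCauchyHypersurface.eq_of_mem_of_mem (WithTop.coe_le_coe.mpr le_top)
      𝒟₂.isCauchyHypersurface hδc.1 hδc.2.1 ht₁ ht₂ ((hmem t₁ ht₁).1 h₁) ((hmem t₂ ht₂).1 h₂)

/-- **A piece of an endless timelike curve of `M̃` inside `π j₁(M₁)` meets `Σ̃`, exactly once**
(lift to `M₁`: the crossings of `Σ̃` on the piece are the crossings of `ι₁(N)` by the lift,
`Σ̃ ∩ π j₁(M₁) = π j₁(ι₁(N))`). [cite: HawkingEllis1973CUP, §7.6, p. 250] -/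
theorem crossing_inl (h : ¬ 𝔠.HasCorrespondingBoundaryPoints) {γ : ℝ → 𝔠.Glued} {s : Set ℝ}
    (hγ : 𝔠.gluedMetric.IsEndlessTimelikeCurve (𝔠.gluedTimeOrientation h) γ s) {t₀ : ℝ}
    (ht₀ : t₀ ∈ s) (hγt₀ : γ t₀ ∈ range 𝔠.inl) :
    (∃ t ∈ connectedComponentIn (s ∩ γ ⁻¹' range 𝔠.inl) t₀, γ t ∈ range (𝔠.inr ∘ 𝒟₂.embed)) ∧
      ∀ t₁ ∈ connectedComponentIn (s ∩ γ ⁻¹' range 𝔠.inl) t₀,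
        ∀ t₂ ∈ connectedComponentIn (s ∩ γ ⁻¹' range 𝔠.inl) t₀,
          γ t₁ ∈ range (𝔠.inr ∘ 𝒟₂.embed) → γ t₂ ∈ range (𝔠.inr ∘ 𝒟₂.embed) → t₁ = t₂ := by
  haveI := 𝔠.t2Space_glued h
  obtain ⟨δ, hδ, hδc⟩ := LorentzianMetric.exists_lift_isEndlessTimelikeCurve 𝒟₁.timeOrientation
    (𝔠.gluedTimeOrientation h) 𝔠.isIsometricImmersion_inl (𝔠.preservesTimeOrientation_inl h)
    𝔠.glueData.inl_injective 𝔠.isLocalDiffeomorph_inl hγ ht₀ hγt₀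
  -- a crossing of `Σ̃` on the piece is a crossing of `ι₁(N)` by the lift, and conversely
  have hmem : ∀ t ∈ connectedComponentIn (s ∩ γ ⁻¹' range 𝔠.inl) t₀,
      (γ t ∈ range (𝔠.inr ∘ 𝒟₂.embed) ↔ δ t ∈ range 𝒟₁.embed) := fun t ht ↦ by
    constructor
    · intro hx
      obtain ⟨u, hu⟩ := 𝔠.mem_range_inl_embed_of_mem hx ⟨δ t, hδ t ht⟩
      refine ⟨u, 𝔠.glueData.inl_injective ?_⟩
      change 𝔠.inl (𝒟₁.embed u) = 𝔠.inl (δ t)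
      rw [hδ t ht]
      exact hu
    · rintro ⟨u, hu⟩
      have : γ t = 𝔠.inl (𝒟₁.embed u) := by rw [hu, hδ t ht]
      rw [this]
      exact 𝔠.inl_embed_mem u
  refine ⟨?_, fun t₁ ht₁ t₂ ht₂ h₁ h₂ ↦ ?_⟩
  · obtain ⟨t, ⟨ht, hx⟩, -⟩ := 𝒟₁.isCauchyHypersurface δ _ hδc
    exact ⟨t, ht, (hmem t ht).2 hx⟩
  · exact LorentzianMetric.IsCauchyHypersurface.eq_of_mem_of_mem (WithTop.coe_le_coe.mpr le_top)
      𝒟₁.isCauchyHypersurface hδc.1 hδc.2.1 ht₁ ht₂ ((hmem t₁ ht₁).1 h₁) ((hmem t₂ ht₂).1 h₂)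

/-- **A piece of an endless timelike curve of `M̃` inside the overlap `π j₁(U)` meets `Σ̃`**
(lift to the open sub-spacetime `U`, in which `ι₁(N)` is a Cauchy hypersurface).
[cite: Sbierski2016AHP, §3.3, proof of Thm. 5 (global hyperbolicity step)] -/
theorem crossing_overlap (h : ¬ 𝔠.HasCorrespondingBoundaryPoints) {γ : ℝ → 𝔠.Glued} {s : Set ℝ}
    (hγ : 𝔠.gluedMetric.IsEndlessTimelikeCurve (𝔠.gluedTimeOrientation h) γ s) {t₀ : ℝ}
    (ht₀ : t₀ ∈ s) (hγt₀ : γ t₀ ∈ range (𝔠.inl ∘ (Subtype.val : 𝔠.opens → 𝒟₁.carrier))) :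
    ∃ t ∈ connectedComponentIn (s ∩ γ ⁻¹' range (𝔠.inl ∘ (Subtype.val : 𝔠.opens → 𝒟₁.carrier))) t₀,
      γ t ∈ range (𝔠.inr ∘ 𝒟₂.embed) := by
  haveI := 𝔠.t2Space_glued h
  obtain ⟨δ, hδ, hδc⟩ := LorentzianMetric.exists_lift_isEndlessTimelikeCurve
    (𝒟₁.timeOrientation.restrict PseudoRiemannianMetric.contMDiff_restrict_holds
      𝒟₁.timeOrientation.contMDiff_restrict_holds 𝔠.opens)
    (𝔠.gluedTimeOrientation h) 𝔠.isIsometricImmersion_inl_comp_subtypeVal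
    (𝔠.preservesTimeOrientation_inl_comp_subtypeVal h) 𝔠.isLocalDiffeomorph_inl_comp_subtypeVal.2
    𝔠.isLocalDiffeomorph_inl_comp_subtypeVal.1 hγ ht₀ hγt₀
  obtain ⟨t, ⟨ht, x, hx⟩, -⟩ := 𝔠.isCauchyHypersurface δ _ hδc
  refine ⟨t, ht, ?_⟩
  have : γ t = 𝔠.inl (𝒟₁.embed x) := by rw [← hδ t ht, comp_apply, ← hx]
  rw [this]
  exact 𝔠.inl_embed_mem x

/-- Every parameter has a parameter neighbourhood containing at most one crossing of `Σ̃`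
(the curve stays in the open piece `π j₁(M₁)` or `π j₂(M₂)` near the parameter, where crossings
are unique, `crossing_inl`/`crossing_inr`). [cite: Sbierski2016AHP, §3.3, proof of Thm. 5 (global hyperbolicity step)] -/
theorem crossing_locally_unique (h : ¬ 𝔠.HasCorrespondingBoundaryPoints) {γ : ℝ → 𝔠.Glued}
    {s : Set ℝ} (hγ : 𝔠.gluedMetric.IsEndlessTimelikeCurve (𝔠.gluedTimeOrientation h) γ s)
    {t : ℝ} (ht : t ∈ s) :
    ∃ ε > 0, ∀ t₁ ∈ s, ∀ t₂ ∈ s, |t₁ - t| < ε → |t₂ - t| < ε →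
      γ t₁ ∈ range (𝔠.inr ∘ 𝒟₂.embed) → γ t₂ ∈ range (𝔠.inr ∘ 𝒟₂.embed) → t₁ = t₂ := by
  have hcont : ContinuousAt γ t := (hγ.2.1 t ht).1.continuousAt
  have key : ∀ (O : Set 𝔠.Glued), IsOpen O → γ t ∈ O →
      (∀ t₁ ∈ connectedComponentIn (s ∩ γ ⁻¹' O) t, ∀ t₂ ∈ connectedComponentIn (s ∩ γ ⁻¹' O) t,
        γ t₁ ∈ range (𝔠.inr ∘ 𝒟₂.embed) → γ t₂ ∈ range (𝔠.inr ∘ 𝒟₂.embed) → t₁ = t₂) →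
      ∃ ε > 0, ∀ t₁ ∈ s, ∀ t₂ ∈ s, |t₁ - t| < ε → |t₂ - t| < ε →
        γ t₁ ∈ range (𝔠.inr ∘ 𝒟₂.embed) → γ t₂ ∈ range (𝔠.inr ∘ 𝒟₂.embed) → t₁ = t₂ := by
    intro O hO hγO huniq
    obtain ⟨ε, hε, hball⟩ := Metric.mem_nhds_iff.1 (hcont.preimage_mem_nhds (hO.mem_nhds hγO))
    have hpre : IsPreconnected (Metric.ball t ε ∩ s) := by
      rw [Real.ball_eq_Ioo]
      exact isPreconnected_iff_ordConnected.2 (ordConnected_Ioo.inter hγ.1)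
    have hsubJ : Metric.ball t ε ∩ s ⊆ connectedComponentIn (s ∩ γ ⁻¹' O) t :=
      hpre.subset_connectedComponentIn ⟨Metric.mem_ball_self hε, ht⟩
        fun t' ht' ↦ ⟨ht'.2, hball ht'.1⟩
    refine ⟨ε, hε, fun t₁ ht₁ t₂ ht₂ h₁ h₂ ↦ huniq t₁ (hsubJ ⟨?_, ht₁⟩) t₂ (hsubJ ⟨?_, ht₂⟩)⟩
    · rw [Metric.mem_ball, Real.dist_eq]; exact h₁
    · rw [Metric.mem_ball, Real.dist_eq]; exact h₂
  obtain (hl | hr) := (𝔠.glueData.range_inl_union_range_inr ▸ mem_univ (γ t) :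
    γ t ∈ range 𝔠.inl ∪ range 𝔠.inr)
  · exact key _ 𝔠.glueData.isOpen_range_inl hl (crossing_inl h hγ ht hl).2
  · exact key _ 𝔠.glueData.isOpen_range_inr hr (crossing_inr h hγ ht hr).2

/-- **Between a parameter mapped outside the overlap and another mapped outside the overlap, with
both pieces visited in between, there is a crossing**: if `a, b ∈ s`, `γ a, γ b ∉ π j₁(U)`, and
`γ([a, b])` meets both `π j₁(M₁)` and `π j₂(M₂)`, then `γ` crosses `Σ̃` strictly between `a` and
`b` — `γ([a, b])` is connected, so it meets the overlap `π j₁(U)` at some `t₂`; the piece through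
`t₂` inside the overlap stays in `(a, b)` and meets `Σ̃` (`crossing_overlap`).
[cite: Sbierski2016AHP, §3.3, proof of Thm. 5 (global hyperbolicity step)] -/
theorem exists_crossing_between (h : ¬ 𝔠.HasCorrespondingBoundaryPoints) {γ : ℝ → 𝔠.Glued}
    {s : Set ℝ} (hγ : 𝔠.gluedMetric.IsEndlessTimelikeCurve (𝔠.gluedTimeOrientation h) γ s)
    {a b : ℝ} (ha : a ∈ s) (hb : b ∈ s)
    (haO : γ a ∉ range (𝔠.inl ∘ (Subtype.val : 𝔠.opens → 𝒟₁.carrier)))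
    (hbO : γ b ∉ range (𝔠.inl ∘ (Subtype.val : 𝔠.opens → 𝒟₁.carrier)))
    (hinl : ∃ t ∈ Icc a b, γ t ∈ range 𝔠.inl) (hinr : ∃ t ∈ Icc a b, γ t ∈ range 𝔠.inr) :
    ∃ t ∈ Ioo a b, γ t ∈ range (𝔠.inr ∘ 𝒟₂.embed) := by
  set O := range (𝔠.inl ∘ (Subtype.val : 𝔠.opens → 𝒟₁.carrier)) with hOdef
  have hOeq : O = range 𝔠.inl ∩ range 𝔠.inr := 𝔠.range_inl_comp_subtypeVal
  have hIcc : Icc a b ⊆ s := hγ.1.out ha hb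
  have hcont : ContinuousOn γ (Icc a b) := fun t ht ↦
    (hγ.2.1 t (hIcc ht)).1.continuousAt.continuousWithinAt
  obtain ⟨t₂, ht₂, hγt₂⟩ : ∃ t₂ ∈ Icc a b, γ t₂ ∈ O := by
    have hpre : IsPreconnected (γ '' Icc a b) := isPreconnected_Icc.image γ hcont
    obtain ⟨ti, hti, hγti⟩ := hinl
    obtain ⟨tr, htr, hγtr⟩ := hinr
    obtain ⟨_, ⟨t₂, ht₂, rfl⟩, hmem⟩ := hpre _ _ 𝔠.glueData.isOpen_range_inl
      𝔠.glueData.isOpen_range_inr (by rw [𝔠.glueData.range_inl_union_range_inr]; exact subset_univ _)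
      ⟨γ ti, ⟨ti, hti, rfl⟩, hγti⟩ ⟨γ tr, ⟨tr, htr, rfl⟩, hγtr⟩
    exact ⟨t₂, ht₂, by rw [hOeq]; exact hmem⟩
  have ht₂s : t₂ ∈ s := hIcc ht₂
  set J := connectedComponentIn (s ∩ γ ⁻¹' O) t₂ with hJ
  have hJsub : J ⊆ s ∩ γ ⁻¹' O := connectedComponentIn_subset _ _
  have ht₂J : t₂ ∈ J := mem_connectedComponentIn ⟨ht₂s, hγt₂⟩
  have hJord : J.OrdConnected :=
    isPreconnected_iff_ordConnected.1 isPreconnected_connectedComponentIn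
  have haJ : a ∉ J := fun haJ ↦ haO (hJsub haJ).2
  have hbJ : b ∉ J := fun hbJ ↦ hbO (hJsub hbJ).2
  have hJab : J ⊆ Ioo a b := fun t ht ↦ by
    constructor
    · by_contra hle
      exact haJ (hJord.out ht ht₂J ⟨not_lt.1 hle, ht₂.1⟩)
    · by_contra hle
      exact hbJ (hJord.out ht₂J ht ⟨ht₂.2, not_lt.1 hle⟩)
  obtain ⟨t, ht, hx⟩ := crossing_overlap h hγ ht₂s hγt₂
  exact ⟨t, hJab ht, hx⟩

/-- **The overlap piece next to an end point.** If `t₁ < t₃` lie in `s`, `γ((t₁, t₃)) ⊆ π j₁(M₁)`,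
`γ t₃ ∈ π j₂(M₂) ∖ π j₁(M₁)` and `γ t' ∉ π j₂(M₂)` for some `t' ∈ (t₁, t₃)`, then `γ` crosses `Σ̃`
strictly between `t'` and `t₃`: parameters `t⁺ ∈ (t', t₃)` close to `t₃` are mapped into the
overlap (`π j₂(M₂)` is open), and the overlap piece through `t⁺` avoids `t'` and `t₃`, so lies in
`(t', t₃)` and meets `Σ̃` (`crossing_overlap`). [cite: HawkingEllis1973CUP, §7.6, p. 250] -/
theorem exists_crossing_near_right (h : ¬ 𝔠.HasCorrespondingBoundaryPoints) {γ : ℝ → 𝔠.Glued}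
    {s : Set ℝ} (hγ : 𝔠.gluedMetric.IsEndlessTimelikeCurve (𝔠.gluedTimeOrientation h) γ s)
    {t₁ t' t₃ : ℝ} (h1 : t₁ < t') (h3 : t' < t₃) (ht₁ : t₁ ∈ s) (ht₃ : t₃ ∈ s)
    (hinl : ∀ t ∈ Ioo t₁ t₃, γ t ∈ range 𝔠.inl) (hγt' : γ t' ∉ range 𝔠.inr)
    (hγt₃ : γ t₃ ∈ range 𝔠.inr) (hγt₃' : γ t₃ ∉ range 𝔠.inl) :
    ∃ t ∈ Ioo t' t₃, γ t ∈ range (𝔠.inr ∘ 𝒟₂.embed) := by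
  set O := range (𝔠.inl ∘ (Subtype.val : 𝔠.opens → 𝒟₁.carrier)) with hOdef
  have hOeq : O = range 𝔠.inl ∩ range 𝔠.inr := 𝔠.range_inl_comp_subtypeVal
  have hIcc : Icc t₁ t₃ ⊆ s := hγ.1.out ht₁ ht₃
  -- a parameter `t⁺ ∈ (t', t₃)` mapped into the overlap
  have hcont : ContinuousWithinAt γ (Iio t₃) t₃ := (hγ.2.1 t₃ ht₃).1.continuousAt.continuousWithinAt
  have hev : ∀ᶠ t in 𝓝[<] t₃, γ t ∈ range 𝔠.inr :=
    hcont.preimage_mem_nhdsWithin (𝔠.glueData.isOpen_range_inr.mem_nhds hγt₃)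
  have hev' : ∀ᶠ t in 𝓝[<] t₃, t ∈ Ioo t' t₃ := Ioo_mem_nhdsLT h3
  obtain ⟨tp, ⟨htp1, htp2⟩, htp⟩ := (hev'.and hev).exists
  have htps : tp ∈ s := hIcc ⟨(h1.trans htp1).le, htp2.le⟩
  have htpO : γ tp ∈ O := by
    rw [hOeq]; exact ⟨hinl tp ⟨h1.trans htp1, htp2⟩, htp⟩
  -- the overlap piece through `t⁺` lies in `(t', t₃)`
  set J := connectedComponentIn (s ∩ γ ⁻¹' O) tp with hJ
  have hJsub : J ⊆ s ∩ γ ⁻¹' O := connectedComponentIn_subset _ _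
  have htpJ : tp ∈ J := mem_connectedComponentIn ⟨htps, htpO⟩
  have hJord : J.OrdConnected :=
    isPreconnected_iff_ordConnected.1 isPreconnected_connectedComponentIn
  have ht'J : t' ∉ J := fun ht'J ↦ hγt' (by
    have hm := (hJsub ht'J).2
    rw [mem_preimage, hOeq] at hm
    exact hm.2)
  have ht₃J : t₃ ∉ J := fun ht₃J ↦ hγt₃' (by
    have hm := (hJsub ht₃J).2
    rw [mem_preimage, hOeq] at hm
    exact hm.1)
  have hJab : J ⊆ Ioo t' t₃ := fun t ht ↦ by
    constructor
    · by_contra hle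
      exact ht'J (hJord.out ht htpJ ⟨not_lt.1 hle, htp1.le⟩)
    · by_contra hle
      exact ht₃J (hJord.out htpJ ht ⟨htp2.le, not_lt.1 hle⟩)
  obtain ⟨t, ht, hx⟩ := crossing_overlap h hγ htps htpO
  exact ⟨t, hJab ht, hx⟩

/-- Time dual of `exists_crossing_near_right`: with `γ t₁ ∈ π j₂(M₂) ∖ π j₁(M₁)`,
`γ((t₁, t₃)) ⊆ π j₁(M₁)` and `γ t' ∉ π j₂(M₂)`, there is a crossing strictly between `t₁` and
`t'`. [cite: HawkingEllis1973CUP, §7.6, p. 250] -/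
theorem exists_crossing_near_left (h : ¬ 𝔠.HasCorrespondingBoundaryPoints) {γ : ℝ → 𝔠.Glued}
    {s : Set ℝ} (hγ : 𝔠.gluedMetric.IsEndlessTimelikeCurve (𝔠.gluedTimeOrientation h) γ s)
    {t₁ t' t₃ : ℝ} (h1 : t₁ < t') (h3 : t' < t₃) (ht₁ : t₁ ∈ s) (ht₃ : t₃ ∈ s)
    (hinl : ∀ t ∈ Ioo t₁ t₃, γ t ∈ range 𝔠.inl) (hγt' : γ t' ∉ range 𝔠.inr)
    (hγt₁ : γ t₁ ∈ range 𝔠.inr) (hγt₁' : γ t₁ ∉ range 𝔠.inl) :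
    ∃ t ∈ Ioo t₁ t', γ t ∈ range (𝔠.inr ∘ 𝒟₂.embed) := by
  set O := range (𝔠.inl ∘ (Subtype.val : 𝔠.opens → 𝒟₁.carrier)) with hOdef
  have hOeq : O = range 𝔠.inl ∩ range 𝔠.inr := 𝔠.range_inl_comp_subtypeVal
  have hIcc : Icc t₁ t₃ ⊆ s := hγ.1.out ht₁ ht₃
  have hcont : ContinuousWithinAt γ (Ioi t₁) t₁ := (hγ.2.1 t₁ ht₁).1.continuousAt.continuousWithinAt
  have hev : ∀ᶠ t in 𝓝[>] t₁, γ t ∈ range 𝔠.inr :=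
    hcont.preimage_mem_nhdsWithin (𝔠.glueData.isOpen_range_inr.mem_nhds hγt₁)
  have hev' : ∀ᶠ t in 𝓝[>] t₁, t ∈ Ioo t₁ t' := Ioo_mem_nhdsGT h1
  obtain ⟨tp, ⟨htp1, htp2⟩, htp⟩ := (hev'.and hev).exists
  have htps : tp ∈ s := hIcc ⟨htp1.le, (htp2.trans h3).le⟩
  have htpO : γ tp ∈ O := by
    rw [hOeq]; exact ⟨hinl tp ⟨htp1, htp2.trans h3⟩, htp⟩
  set J := connectedComponentIn (s ∩ γ ⁻¹' O) tp with hJ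
  have hJsub : J ⊆ s ∩ γ ⁻¹' O := connectedComponentIn_subset _ _
  have htpJ : tp ∈ J := mem_connectedComponentIn ⟨htps, htpO⟩
  have hJord : J.OrdConnected :=
    isPreconnected_iff_ordConnected.1 isPreconnected_connectedComponentIn
  have ht'J : t' ∉ J := fun ht'J ↦ hγt' (by
    have hm := (hJsub ht'J).2
    rw [mem_preimage, hOeq] at hm
    exact hm.2)
  have ht₁J : t₁ ∉ J := fun ht₁J ↦ hγt₁' (by
    have hm := (hJsub ht₁J).2
    rw [mem_preimage, hOeq] at hm
    exact hm.1)
  have hJab : J ⊆ Ioo t₁ t' := fun t ht ↦ by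
    constructor
    · by_contra hle
      exact ht₁J (hJord.out ht htpJ ⟨not_lt.1 hle, htp1.le⟩)
    · by_contra hle
      exact ht'J (hJord.out htpJ ht ⟨htp2.le, not_lt.1 hle⟩)
  obtain ⟨t, ht, hx⟩ := crossing_overlap h hγ htps htpO
  exact ⟨t, hJab ht, hx⟩

/-- **No two consecutive crossings** (the relative uniqueness argument). Let `t₁ < t₃` be
crossings of `Σ̃` with none strictly in between. `γ([t₁, t₃])` does not stay in `π j₂(M₂)` (two
crossings on one piece of `π j₂(M₂)` coincide, `crossing_inr`), so `γ t' ∉ π j₂(M₂)` for some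
`t' ∈ (t₁, t₃)`. If moreover `γ t'' ∉ π j₁(M₁)` for some `t'' ∈ (t₁, t₃)`, the overlap piece
between `t'` and `t''` carries a crossing (`exists_crossing_between`). Otherwise
`γ((t₁, t₃)) ⊆ π j₁(M₁)`: if both `γ t₁, γ t₃ ∈ π j₁(M₁)` one piece of `π j₁(M₁)` carries the two
crossings (`crossing_inl`); if not, the overlap piece next to the end point outside `π j₁(M₁)`
carries a crossing strictly in between (`exists_crossing_near_right/left`). Hawking–Ellis 1973,
§7.6, p. 250 (the image of `θ(𝓢)` is a Cauchy surface of `𝓜⁺`). [cite: HawkingEllis1973CUP, §7.6, p. 250] -/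
theorem no_consecutive_crossings (h : ¬ 𝔠.HasCorrespondingBoundaryPoints) {γ : ℝ → 𝔠.Glued}
    {s : Set ℝ} (hγ : 𝔠.gluedMetric.IsEndlessTimelikeCurve (𝔠.gluedTimeOrientation h) γ s)
    {t₁ t₃ : ℝ} (h13 : t₁ < t₃) (ht₁ : t₁ ∈ s) (ht₃ : t₃ ∈ s)
    (h₁ : γ t₁ ∈ range (𝔠.inr ∘ 𝒟₂.embed)) (h₃ : γ t₃ ∈ range (𝔠.inr ∘ 𝒟₂.embed))
    (hno : ∀ t ∈ Ioo t₁ t₃, γ t ∉ range (𝔠.inr ∘ 𝒟₂.embed)) : False := by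
  have hIcc : Icc t₁ t₃ ⊆ s := hγ.1.out ht₁ ht₃
  have h₁' : γ t₁ ∈ range 𝔠.inr := 𝔠.range_gluedEmbed_subset h₁
  have h₃' : γ t₃ ∈ range 𝔠.inr := 𝔠.range_gluedEmbed_subset h₃
  -- `[t₁, t₃]` leaves `π j₂(M₂)`
  obtain ⟨t', ht', hγt'⟩ : ∃ t' ∈ Ioo t₁ t₃, γ t' ∉ range 𝔠.inr := by
    by_contra hall
    push Not at hall
    have hsub : Icc t₁ t₃ ⊆ connectedComponentIn (s ∩ γ ⁻¹' range 𝔠.inr) t₁ := by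
      refine isPreconnected_Icc.subset_connectedComponentIn (left_mem_Icc.2 h13.le) fun t ht ↦ ⟨hIcc ht, ?_⟩
      rcases eq_or_lt_of_le ht.1 with rfl | hlt
      · exact h₁'
      rcases eq_or_lt_of_le ht.2 with rfl | hlt'
      · exact h₃'
      · exact hall t ⟨hlt, hlt'⟩
    have := (crossing_inr h hγ ht₁ h₁').2 t₁ (hsub (left_mem_Icc.2 h13.le)) t₃
      (hsub (right_mem_Icc.2 h13.le)) h₁ h₃
    exact absurd this h13.ne
  have hcover : ∀ p : 𝔠.Glued, p ∈ range 𝔠.inl ∨ p ∈ range 𝔠.inr := fun p ↦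
    (𝔠.glueData.range_inl_union_range_inr ▸ mem_univ p : p ∈ range 𝔠.inl ∪ range 𝔠.inr)
  have hO : ∀ p : 𝔠.Glued, p ∈ range (𝔠.inl ∘ (Subtype.val : 𝔠.opens → 𝒟₁.carrier)) →
      p ∈ range 𝔠.inl ∧ p ∈ range 𝔠.inr := fun p hp ↦ by
    rw [𝔠.range_inl_comp_subtypeVal] at hp
    exact hp
  have ht's : t' ∈ s := hIcc ⟨ht'.1.le, ht'.2.le⟩
  have hγt'l : γ t' ∈ range 𝔠.inl := (hcover (γ t')).resolve_right hγt'
  have ht'O : γ t' ∉ range (𝔠.inl ∘ (Subtype.val : 𝔠.opens → 𝒟₁.carrier)) :=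
    fun hp ↦ hγt' (hO _ hp).2
  by_cases hex : ∃ t'' ∈ Ioo t₁ t₃, γ t'' ∉ range 𝔠.inl
  · -- the curve also leaves `π j₁(M₁)`: the same-data argument
    obtain ⟨t'', ht'', hγt''⟩ := hex
    have ht''s : t'' ∈ s := hIcc ⟨ht''.1.le, ht''.2.le⟩
    have hne : t' ≠ t'' := by
      rintro rfl
      exact hγt'' hγt'l
    have ht''O : γ t'' ∉ range (𝔠.inl ∘ (Subtype.val : 𝔠.opens → 𝒟₁.carrier)) :=
      fun hp ↦ hγt'' (hO _ hp).1
    have hγt''r : γ t'' ∈ range 𝔠.inr := (hcover (γ t'')).resolve_left hγt''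
    rcases lt_or_gt_of_ne hne with hlt | hlt
    · obtain ⟨t, ht, hx⟩ := exists_crossing_between h hγ ht's ht''s ht'O ht''O
        ⟨t', left_mem_Icc.2 hlt.le, hγt'l⟩ ⟨t'', right_mem_Icc.2 hlt.le, hγt''r⟩
      exact hno t ⟨ht'.1.trans ht.1, ht.2.trans ht''.2⟩ hx
    · obtain ⟨t, ht, hx⟩ := exists_crossing_between h hγ ht''s ht's ht''O ht'O
        ⟨t', right_mem_Icc.2 hlt.le, hγt'l⟩ ⟨t'', left_mem_Icc.2 hlt.le, hγt''r⟩
      exact hno t ⟨ht''.1.trans ht.1, ht.2.trans ht'.2⟩ hx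
  · -- `γ((t₁, t₃)) ⊆ π j₁(M₁)`
    push Not at hex
    by_cases hl₁ : γ t₁ ∈ range 𝔠.inl
    · by_cases hl₃ : γ t₃ ∈ range 𝔠.inl
      · -- one piece of `π j₁(M₁)` carries both crossings
        have hsub : Icc t₁ t₃ ⊆ connectedComponentIn (s ∩ γ ⁻¹' range 𝔠.inl) t₁ := by
          refine isPreconnected_Icc.subset_connectedComponentIn (left_mem_Icc.2 h13.le)
            fun t ht ↦ ⟨hIcc ht, ?_⟩
          rcases eq_or_lt_of_le ht.1 with rfl | hlt
          · exact hl₁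
          rcases eq_or_lt_of_le ht.2 with rfl | hlt'
          · exact hl₃
          · exact hex t ⟨hlt, hlt'⟩
        have := (crossing_inl h hγ ht₁ hl₁).2 t₁ (hsub (left_mem_Icc.2 h13.le)) t₃
          (hsub (right_mem_Icc.2 h13.le)) h₁ h₃
        exact absurd this h13.ne
      · obtain ⟨t, ht, hx⟩ := exists_crossing_near_right h hγ ht'.1 ht'.2 ht₁ ht₃ hex hγt' h₃' hl₃
        exact hno t ⟨ht'.1.trans ht.1, ht.2⟩ hx
    · obtain ⟨t, ht, hx⟩ := exists_crossing_near_left h hγ ht'.1 ht'.2 ht₁ ht₃ hex hγt' h₁' hl₁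
      exact hno t ⟨ht.1, ht.2.trans ht'.2⟩ hx

/-- **At most one crossing.** Two crossings `t₁ < t₃` of `Σ̃` by an endless timelike curve of
`M̃` lead to a contradiction: crossings are locally unique (`crossing_locally_unique`) and form
a closed set of parameters in `[t₁, t₃]` (`Σ̃` is closed), so there is a least crossing
`t₃' > t₁`, consecutive to `t₁` — excluded by `no_consecutive_crossings`.
[cite: Sbierski2016AHP, §3.3, proof of Thm. 5 (global hyperbolicity step)] -/
theorem not_two_crossings (h : ¬ 𝔠.HasCorrespondingBoundaryPoints) {γ : ℝ → 𝔠.Glued}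
    {s : Set ℝ} (hγ : 𝔠.gluedMetric.IsEndlessTimelikeCurve (𝔠.gluedTimeOrientation h) γ s)
    {t₁ t₃ : ℝ} (h13 : t₁ < t₃) (ht₁ : t₁ ∈ s) (ht₃ : t₃ ∈ s)
    (h₁ : γ t₁ ∈ range (𝔠.inr ∘ 𝒟₂.embed)) (h₃ : γ t₃ ∈ range (𝔠.inr ∘ 𝒟₂.embed)) : False := by
  have hIcc : Icc t₁ t₃ ⊆ s := hγ.1.out ht₁ ht₃
  have hcont : ContinuousOn γ (Icc t₁ t₃) := fun t ht ↦
    (hγ.2.1 t (hIcc ht)).1.continuousAt.continuousWithinAt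
  obtain ⟨ε, hε, huniq⟩ := crossing_locally_unique h hγ ht₁
  have hε3 : t₁ + ε ≤ t₃ := by
    by_contra hlt
    have := huniq t₁ ht₁ t₃ ht₃ (by simp [hε]) (by rw [abs_lt]; constructor <;> linarith) h₁ h₃
    exact absurd this h13.ne
  set C : Set ℝ := Icc (t₁ + ε) t₃ ∩ γ ⁻¹' range (𝔠.inr ∘ 𝒟₂.embed) with hC
  have hCcl : IsClosed C := (hcont.mono (Icc_subset_Icc_left (by linarith))).preimage_isClosed_of_isClosed
    isClosed_Icc 𝔠.isClosed_range_gluedEmbed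
  have hCne : C.Nonempty := ⟨t₃, ⟨hε3, le_rfl⟩, h₃⟩
  have hCbdd : BddBelow C := ⟨t₁ + ε, fun t ht ↦ ht.1.1⟩
  set t₃' := sInf C with ht₃'
  have ht₃'C : t₃' ∈ C := hCcl.csInf_mem hCne hCbdd
  have h13' : t₁ < t₃' := by linarith [ht₃'C.1.1]
  have ht₃'s : t₃' ∈ s := hIcc ⟨h13'.le, ht₃'C.1.2⟩
  refine no_consecutive_crossings h hγ h13' ht₁ ht₃'s h₁ ht₃'C.2 fun t ht hx ↦ ?_
  by_cases htε : t < t₁ + ε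
  · have := huniq t₁ ht₁ t (hIcc ⟨ht.1.le, ht.2.le.trans ht₃'C.1.2⟩) (by simp [hε])
      (by rw [abs_lt]; constructor <;> linarith [ht.1]) h₁ hx
    exact absurd this ht.1.ne
  · have htC : t ∈ C := ⟨⟨not_lt.1 htε, ht.2.le.trans ht₃'C.1.2⟩, hx⟩
    exact absurd (csInf_le hCbdd htC) (not_le.2 ht.2)

variable (𝔠)

/-- **`Σ̃ = π j₂(ι₂(X))` is a Cauchy hypersurface of the glued spacetime `(M̃, g̃, T̃)`**
(Hawking–Ellis 1973, §7.6, p. 250; relative form of Sbierski 2016, §3.3, proof of Thm. 5): every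
endless timelike curve of `M̃` meets `Σ̃` — the piece through any of its points inside `π j₁(M₁)`
or `π j₂(M₂)` lifts to an endless timelike curve of `M₁` or `M₂` (`crossing_inl`, `crossing_inr`)
— and at most once (`not_two_crossings`). [cite: HawkingEllis1973CUP, §7.6, p. 250] -/
theorem isCauchyHypersurface_glued (h : ¬ 𝔠.HasCorrespondingBoundaryPoints) :
    𝔠.gluedMetric.IsCauchyHypersurface (𝔠.gluedTimeOrientation h) (range (𝔠.inr ∘ 𝒟₂.embed)) := by
  intro γ s hγ
  obtain ⟨t₀, ht₀⟩ := hγ.2.2.1.1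
  obtain ⟨tc, htc, hxc⟩ : ∃ tc ∈ s, γ tc ∈ range (𝔠.inr ∘ 𝒟₂.embed) := by
    rcases (𝔠.glueData.range_inl_union_range_inr ▸ mem_univ (γ t₀) :
      γ t₀ ∈ range 𝔠.inl ∪ range 𝔠.inr) with hl | hr
    · obtain ⟨⟨t, ht, hx⟩, -⟩ := crossing_inl h hγ ht₀ hl
      exact ⟨t, (connectedComponentIn_subset _ _ ht).1, hx⟩
    · obtain ⟨⟨t, ht, hx⟩, -⟩ := crossing_inr h hγ ht₀ hr
      exact ⟨t, (connectedComponentIn_subset _ _ ht).1, hx⟩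
  refine ⟨tc, ⟨htc, hxc⟩, fun t ⟨ht, hx⟩ ↦ ?_⟩
  by_contra hne
  rcases lt_or_gt_of_ne hne with hlt | hlt
  · exact not_two_crossings h hγ hlt ht htc hx hxc
  · exact not_two_crossings h hγ hlt htc ht hxc hx

end RelCommonDevelopment

end CauchyDevelopment

end Developments

end Literature.Geometry.Lorentzian

end
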